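import Mathlib
import Summits.Ventures.PercRepro2.MixChordOLeafRoot

/-!
# The `o`-class chord at the OTHER root: the `o`-edge `{o, a₂}` on the `a₃`-leaf classes
(blind cell PercRepro2, night-1 g22; proofs/NIGHT1-G22.md §2)

The mixed chord with normaliser `D` is symmetric in the two roots (`nMixChord_normD_root_swap`:
`Gc_swap` and `PDEvent_root_swap`), so MixChordOLeafRoot.lean's theorems along `{o, a₁}` transfer
to the `o`-edge `{o, a₂}`: **`dChord_o_edge₂_of_leaf_either_root`**, **`dChord_o_edge₂_of_leaf_o`**
(the `D`-chord), and the chain's row **`dz2Chord_o_edge₂_of_leaf_either_root`**,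
**`dz2Chord_o_edge₂_of_leaf_o`** (the `(D·Z)²`-chord, unconditional on the classes).  With
MixChordOLeafRoot.lean: the `o`-class row of the chain of record holds along BOTH literal `o`-edges
whenever `a₃` is a leaf at a root or at `o`.  Own code; standard axioms.
-/

namespace Summit.Ventures.PercRepro2

open UnionCluster CovForm

namespace Mix

section Mirror

variable {V : Type*} {E : Type*} [Fintype E] [DecidableEq E] [Fintype V] [DecidableEq V]
  {R : Type*} [Field R] [LinearOrder R] [IsStrictOrderedRing R]

variable (p : E → R) (ends : E → Sym2 V) {o a₁ a₂ a₃ : V} (b : V) {f g : E}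

omit [Fintype V] [DecidableEq V] [IsStrictOrderedRing R] in
/-- The `D`-chord is symmetric in the roots. -/
lemma nMixChord_normD_root_swap (o a₁ a₂ a₃ : V) (f : E) :
    NMixChord (normD ends a₂ a₁ a₃) p ends o a₂ a₁ a₃ b f ↔
      NMixChord (normD ends a₁ a₂ a₃) p ends o a₁ a₂ a₃ b f := by
  unfold NMixChord normD
  rw [Gc_swap p, Gc_swap (Function.update p f 0), Gc_swap (Function.update p f 1),
    PDEvent_root_swap]

/-- **The `o`-class `D`-chord along `f = {o, a₂}` whenever `a₃` is a leaf at either root.** -/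
theorem dChord_o_edge₂_of_leaf_either_root (hp : IsProbVec p) (hf : ends f = s(o, a₂))
    (hg : ends g = s(a₃, a₂) ∨ ends g = s(a₃, a₁)) (hleaf : ∀ e, a₃ ∈ ends e → e = g)
    (h32 : a₃ ≠ a₂) (h31 : a₃ ≠ a₁) (ho : o ≠ a₃) (hb : b ≠ a₃) :
    NMixChord (normD ends a₁ a₂ a₃) p ends o a₁ a₂ a₃ b f :=
  (nMixChord_normD_root_swap p ends b o a₁ a₂ a₃ f).1
    (dChord_o_edge_of_leaf_either_root p ends b hp hf hg.symm hleaf h31 h32 ho hb)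

/-- **The `o`-class `D`-chord along `f = {o, a₂}` whenever `a₃` is a leaf at `o`.** -/
theorem dChord_o_edge₂_of_leaf_o (hp : IsProbVec p) (hf : ends f = s(o, a₂))
    (hg : ends g = s(a₃, o)) (hleaf : ∀ e, a₃ ∈ ends e → e = g)
    (h3o : a₃ ≠ o) (h31 : a₃ ≠ a₁) (h32 : a₃ ≠ a₂) (hb : b ≠ a₃) :
    NMixChord (normD ends a₁ a₂ a₃) p ends o a₁ a₂ a₃ b f :=
  (nMixChord_normD_root_swap p ends b o a₁ a₂ a₃ f).1
    (dChord_o_edge_of_leaf_o p ends b hp hf hg hleaf h3o h32 h31 hb)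

/-- **The chain's row along `{o, a₂}` whenever `a₃` is a leaf at either root.** -/
theorem dz2Chord_o_edge₂_of_leaf_either_root (hp : IsProbVec p) (hf : ends f = s(o, a₂))
    (hg : ends g = s(a₃, a₂) ∨ ends g = s(a₃, a₁)) (hleaf : ∀ e, a₃ ∈ ends e → e = g)
    (h32 : a₃ ≠ a₂) (h31 : a₃ ≠ a₁) (ho : o ≠ a₃) (hb : b ≠ a₃) :
    NMixChord (normDZ2 ends a₁ a₂ a₃) p ends o a₁ a₂ a₃ b f :=
  nMixChord_DZ2_of_D hp (dChord_o_edge₂_of_leaf_either_root p ends b hp hf hg hleaf h32 h31 ho hb)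
    (PendantRoot.HCov_pendant_either_root (Function.update p f 0) (hp.update f le_rfl zero_le_one)
      ends hleaf hg h31 h32 ho hb)

/-- **The chain's row along `{o, a₂}` whenever `a₃` is a leaf at `o`.** -/
theorem dz2Chord_o_edge₂_of_leaf_o (hp : IsProbVec p) (hf : ends f = s(o, a₂))
    (hg : ends g = s(a₃, o)) (hleaf : ∀ e, a₃ ∈ ends e → e = g)
    (h3o : a₃ ≠ o) (h31 : a₃ ≠ a₁) (h32 : a₃ ≠ a₂) (hb : b ≠ a₃) :
    NMixChord (normDZ2 ends a₁ a₂ a₃) p ends o a₁ a₂ a₃ b f :=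
  nMixChord_DZ2_of_D hp (dChord_o_edge₂_of_leaf_o p ends b hp hf hg hleaf h3o h31 h32 hb)
    (PendantO.HCov_pendant_o (Function.update p f 0) ends (hp.update f le_rfl zero_le_one) hg hleaf
      h3o h31 h32 hb)

end Mirror

end Mix

end Summit.Ventures.PercRepro2
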